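import Summits.BirchSwinnertonDyer.Rank1Residual.Additive.RamifiedSevenGenusSinnottNorm
import Literature.NumberTheory.IwasawaTheory.SinnottUnitsChiPartGenerator
import HarnessLib

/-!
# `𝒞₇` genus road, row (GENUS-PORT-A3) block (U1g): input (4b) `SinnottSpanShape` of K1ᵘ from the Sinnott value pin,
# modulo ONE print statement (Tsuji 1999 Lemma 6.2 (a), Literature named fact `tsuji1999_lemma62a_cycChiGenerator`),
# and the reduction `genusFactorisationSeven_of_inputs₂₅` of the registered stub to (2b″) ∧ (5)

Cell bsd-cm, seat bsd-cm-k-ty1 g25; SUMMON `wake/SUMMON-bsd-cm-k-ty1-20260830T1731Z.md` (16c4e918e43e0aee) block (U1g):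
«(4b) `SinnottSpanShape F ξu` from the value pin — ★ `GenusFrame.sinnottSpanShape_of_pin` … MANDATORY CHECK (T6) … If the latter:
… state the limit passage as ONE named Literature fact … Then ★ `genusFactorisationSeven_of_inputs₂₅`».  ADDITIVE: the shapes (B1a),
the oriented file, (U1a)–(U1e) are imported and untouched.  HONEST LABEL: (4b) is NOT proved outright — it is REDUCED to the named
fact (Tsuji's Lemma 6.2 (a), whose printed proof runs through the Coleman power series of `1 − ζ` and Ferrero–Washington, not in
the tree); K1ᵘ is NOT proved; no item closes; stmt-BirchSwinnertonDyer-19945 is OPEN; `X12.CMRamifiedSeven` is NOT proved; BSD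
is claimed for no curve.

## (T6) — the check of record (why (4b) is a fact-reduction and not a kernel theorem in this row)

`SinnottSpanShape F ξu` («`𝒞^{η₁} = Λ · e_{η₁}ξ` for the (unique) projector and push») IS Tsuji's Lemma 6.2 (a) at
`(F, p, χ) = (ℚ(√D), 7, η₁ = χ_Dω⁵)` in the pinned-datum currency (`cycChi` = `𝒞 ∩ 𝓤^{η₁}`; `[K₀ : ℚ] = 12` is prime to `7`, so
`e_{η₁} ∈ ℤ₇[G]` and the printed generator `ξ_f^{e_χω_ψ}` is `2 · e_{η₁}ξ_f`, `2 ∈ ℤ₇^×`).  The printed proof (p. 21) is NOT a limit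
passage over finite-level statements: it applies the Coleman map `Col^χ` (Thm. 4.2 / Prop. 5.2), the computation
`Col(ξ_f^{e_χω_ψ}) = −v(T)g_χ(T)·(…)` (Thm. 4.3, Lemma 5.1 (a)) and Ferrero–Washington («`g_χ(T)` is prime to `p`») to divide by
`p^t`.  F4's pins (I)(S)(C)(Cyc) plus the tree's `∃ Col` fact `tsuji1999_thm31_colemanMap` give only that `𝒞^{η₁}` is CYCLIC
(Literature `cycChi_eq_span_symm_of_colemanMap`, PROVED) — not which element generates it; the missing print is exactly
«`Col(e_χ ξ_f)` is a unit multiple of `g_χ`» (Literature `cycChi_eq_span_of_colemanMap_of_isUnit`, PROVED: that sentence ⟹ (4b)).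
Hence: ONE named Literature fact (debt +1, SUMMON budget), no compactness/closedness gap in F4.

## What is proved

* §1 `GenusFrame.finiteDimensional_F₀_and_finrank_le_two`, `GenusFrame.not_seven_dvd_finrank_F₀` (`[ℚ(√D) : ℚ] ≤ 2`, Tsuji's regime `p ∤ [F : ℚ]`).
* §2 ★ `GenusFrame.sinnottSpanShape_of_pin (hT : tsuji1999_lemma62a_cycChiGenerator) (hval : value pin) : SinnottSpanShape F ξu`
  (the fact at the frame's binders, `q = 48`, then Literature `cycChi_eq_span_of_map_cyc_eq_span`).  NON-VACUITY (D883 census):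
  the hypotheses of `SinnottSpanShape` are INHABITED on every frame — `GenusFrame.exists_chiProjector` (p776591), the Sinnott
  units `exists_sinnottUnits` with their push `exists_push` (principality p777523/p778024, norm relations p780861) and
  `e ξraw ∈ 𝒞` by `chiProjector_apply_mem_of_stable` + `act_mem_cyc` + `push_mem_cyc` (p777504 §4 builds exactly these) — so the
  fact's conclusion is exercised by `nonempty_orientedGenusDatum_of_inputs`, not vacuously satisfied.
* §3 ★ `genusFactorisationSeven_of_inputs₂₅ (hT) (h : ∀ F θu, pin → F.IsGlobalNormCoherent (θu^12) ∧ UnitSideIdentityShape F θu)`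
  — conclusion = v11's letter `stub_genusFactorisationSeven` VERBATIM — and ★ `genusUnitSideInputsSeven_of_inputs₂₅ (hT) (h)` —
  conclusion = the REGISTERED zp v12 input-form stub `stub_genusUnitSideInputsSeven` VERBATIM: K1ᵘ REDUCED TO (2b″) ∧ (5) modulo
  Tsuji L6.2 (a).

## References
T. Tsuji, J. Number Theory 78 (1999) §6 Lemma 6.1–6.2 (pp. 20–21), §4 Thm. 4.3 (pp. 12–14), Remark 3 (p. 9) [Tsuji1999];
C. Greither, Ann. Inst. Fourier 42 (1992) Lemma 2.3 [cited via Tsuji1999]; S. Lang, *Cyclotomic Fields I–II* (1990) Ch. 7 §5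
[Lang1990]; K. Kato, Astérisque 295 (2004) §15.5–15.6 (pp. 253–254) [Kato2004Asterisque]; E. de Shalit (1987) II.2.5
[deShalit1987].
-/

noncomputable section

open scoped NumberField
open IsDedekindDomain Field PowerSeries
open Literature.NumberTheory.IwasawaTheory
open Literature.NumberTheory.ComplexMultiplication.EllipticUnits
open Literature.NumberTheory.NumberFields
open Literature.NumberTheory.EllipticCurves
open Literature.NumberTheory.EllipticCurves.IwasawaAlgebra

namespace Summit.BirchSwinnertonDyer.Rank1Residual.Additive.GenusSeven

namespace GenusFrame

variable (F : GenusFrame)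

/-! ## §1 `[ℚ(√D) : ℚ] ≤ 2`, so `7 ∤ [F₀ : ℚ]` (Tsuji's regime `p ∤ [F : ℚ]`, Remark 3) -/

/-- `F₀ = ℚ(√D)` is finite over `ℚ` of degree `≤ 2` (`F₀ ≤ ℚ(r)` for any square root `r` of `D`, a root of `X² − D`).
[cite: Tsuji1999, §3 (p. 5, «F a finite abelian extension of ℚ») and Remark 3 (p. 9, «p ∤ [K : ℚ]»)] -/
theorem finiteDimensional_F₀_and_finrank_le_two : FiniteDimensional ℚ F.F₀ ∧ Module.finrank ℚ F.F₀ ≤ 2 := by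
  obtain ⟨r, hr⟩ := IsAlgClosed.exists_pow_nat_eq (F.D : AlgebraicClosure ℚ) (by norm_num : 0 < 2)
  have hset : {x : AlgebraicClosure ℚ | x ^ 2 = (F.D : AlgebraicClosure ℚ)} ⊆ (IntermediateField.adjoin ℚ {r} :
      IntermediateField ℚ (AlgebraicClosure ℚ)) := by
    intro x hx
    simp only [Set.mem_setOf_eq] at hx
    have h2 : (x - r) * (x + r) = 0 := by ring_nf; rw [hx, hr, sub_self]
    have hr' : r ∈ IntermediateField.adjoin ℚ {r} := IntermediateField.mem_adjoin_simple_self ℚ r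
    rcases mul_eq_zero.mp h2 with h | h
    · rw [sub_eq_zero.mp h]; exact hr'
    · rw [eq_neg_of_add_eq_zero_left h]; exact neg_mem hr'
  have hle : F.F₀ ≤ IntermediateField.adjoin ℚ {r} := by
    rw [F.F₀_eq]
    exact IntermediateField.adjoin_le_iff.mpr hset
  have hroot : Polynomial.aeval r (Polynomial.X ^ 2 - Polynomial.C (F.D : ℚ) : Polynomial ℚ) = 0 := by
    simp [hr]
  have hne : (Polynomial.X ^ 2 - Polynomial.C (F.D : ℚ) : Polynomial ℚ) ≠ 0 :=
    Polynomial.X_pow_sub_C_ne_zero (by norm_num) _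
  have hint : IsIntegral ℚ r := by
    rw [← isAlgebraic_iff_isIntegral]
    exact ⟨_, hne, hroot⟩
  have hdeg : Module.finrank ℚ (IntermediateField.adjoin ℚ {r} : IntermediateField ℚ (AlgebraicClosure ℚ)) ≤ 2 := by
    rw [IntermediateField.adjoin.finrank hint]
    calc (minpoly ℚ r).natDegree ≤ (Polynomial.X ^ 2 - Polynomial.C (F.D : ℚ) : Polynomial ℚ).natDegree :=
          Polynomial.natDegree_le_natDegree (minpoly.degree_le_of_ne_zero ℚ r hne hroot)
      _ = 2 := Polynomial.natDegree_X_pow_sub_C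
  haveI : FiniteDimensional ℚ (IntermediateField.adjoin ℚ {r} : IntermediateField ℚ (AlgebraicClosure ℚ)) :=
    IntermediateField.adjoin.finiteDimensional hint
  haveI : FiniteDimensional ℚ F.F₀ :=
    FiniteDimensional.of_injective (IntermediateField.inclusion hle).toLinearMap (IntermediateField.inclusion hle).injective
  exact ⟨inferInstance, (IntermediateField.finrank_le_of_le_right hle).trans hdeg⟩

/-- **`7 ∤ [F₀ : ℚ]`** (`1 ≤ [F₀ : ℚ] ≤ 2`): the frame is in Tsuji's regime `p ∤ [K : ℚ]` of Remark 3.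
[cite: Tsuji1999, Remark 3 (p. 9, «Under the assumption p ∤ [K : ℚ]»)] -/
theorem not_seven_dvd_finrank_F₀ : ¬ 7 ∣ Module.finrank ℚ F.F₀ := by
  obtain ⟨hfin, h2⟩ := F.finiteDimensional_F₀_and_finrank_le_two
  have h1 : 0 < Module.finrank ℚ F.F₀ := Module.finrank_pos
  omega

/-- The frame's root system read at `f = |D|`: primitive `7^{n+1}|D|`-th roots, compatible. [cite: Tsuji1999, p. 3 (Notation and Convention)] -/
theorem isCompatibleRootSystem_ζsys : CyclotomicUnits.IsCompatibleRootSystem F.d 7 F.ζsys := F.ζsys_compatible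

/-- `ζsys 0` is a primitive `7|D|`-th root of unity (the reading level `m·p`). [cite: Tsuji1999, §4 (p. 12, «χ a character of Gal(ℚ(μ_{fp})/ℚ)»)] -/
theorem isPrimitiveRoot_ζsys_zero : IsPrimitiveRoot (F.ζsys 0) (F.d * 7) := by
  have := F.ζsys_compatible.1 0
  rwa [zero_add, pow_one, mul_comm] at this

/-! ## §2 ★ (4b) from the value pin, modulo Tsuji's Lemma 6.2 (a) -/

/-- ★ **(4b) `SinnottSpanShape F ξu` FROM THE VALUE PIN, modulo the named fact `tsuji1999_lemma62a_cycChiGenerator`** (Tsuji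
1999 Lemma 6.2 (a) «`C^χ` is generated by `ξ_f^{e_χω_ψ}`», at `(F, p, χ, f) = (ℚ(√D), 7, η₁, |D|)`, `q = 48`): for every
projector `e` of `𝓤` onto `𝓤^{η₁}` and every push `ξraw` of the value-pinned Sinnott family with `e ξraw ∈ 𝒞`,
`𝒞^{η₁} = Λ · e ξraw`.  Conditional theorem; the fact is NOT proved here.
[cite: Tsuji1999, §6 Lemma 6.1 and Lemma 6.2 (a) (pp. 20–21)] -/
theorem sinnottSpanShape_of_pin (hT : tsuji1999_lemma62a_cycChiGenerator) {ξu : ∀ n : ℕ, globalUnitsOf (F.layer n)}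
    (hval : ∀ n : ℕ, (((ξu n : globalUnitsOf (F.layer n)) : (AlgebraicClosure ℚ)ˣ) : AlgebraicClosure ℚ) =
      CyclotomicUnits.sinnottNorm (t := 7 ^ (n + 1) * F.d) (F.layer n) (F.ζsys n) 1) :
    SinnottSpanShape F ξu := by
  intro e he ξraw hξraw hmem
  haveI : NeZero F.d := ⟨F.d_ne_zero⟩
  exact hT.cycChi_eq_span (by decide) F.seven_mem_v F.d_pos F.d_coprime_seven F.F₀_le F.not_seven_dvd_finrank_F₀
    F.isPrimitiveRoot_ζsys_zero F.u_topGenerator F.cyclotomicCharacter_γ₀ F.γ₀_mem F.η₁_trivial dvd_rfl F.χD_isPrimitive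
    F.ω_teichmuller GenusFrame.five_le F.nontrivial_reading F.χD_neg_one_eq_pow F.η₁_reading F.isCompatibleRootSystem_ζsys
    F.U he.1 he.2.1 he.2.2 hval (q := 48) (by decide) hξraw hmem

end GenusFrame

/-! ## §3 ★ K1ᵘ reduced to (2b″) ∧ (5), modulo Tsuji's Lemma 6.2 (a) -/

/-- ★ **THE DECOMPOSED REDUCTION OF K1ᵘ with (4b) discharged modulo Tsuji's Lemma 6.2 (a)** (conclusion = the registered stub
`stub_genusFactorisationSeven` VERBATIM; hypotheses: the named fact `tsuji1999_lemma62a_cycChiGenerator` and, per value-pinned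
frame, (2b″) the global norm relations of the twelfth powers of the elliptic family [Kato p. 253 / de Shalit II.2.5 (i)] and
(5) the identity [(15.5.1)]).  Conditional theorem; neither hypothesis is proved here.
[cite: Tsuji1999, §6 Lemma 6.2 (a) (p. 21)] [cite: Kato2004Asterisque, §15.5 (15.5.1) and p. 253 («the norm map … sends _𝔞z_{p^{n+1}𝔣} to _𝔞z_{p^n𝔣}»)] [cite: deShalit1987, II.2.5 Proposition (i)] -/
theorem genusFactorisationSeven_of_inputs₂₅ (hT : tsuji1999_lemma62a_cycChiGenerator)
    (h : ∀ (F : GenusFrame) (θu : ∀ n : ℕ, globalUnitsOf (F.layer n)), IsNormedEllipticUnitFamily F θu →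
      F.IsGlobalNormCoherent (fun n => θu n ^ 12) ∧ UnitSideIdentityShape F θu) :
    ∀ (F : GenusSeven.GenusFrame) (θu : ∀ n : ℕ, globalUnitsOf (F.layer n)),
      GenusSeven.IsNormedEllipticUnitFamily F θu →
        ∃ d : GenusSeven.OrientedGenusDatum F θu, GenusSeven.OrientedGenusFactorisationShape d :=
  genusFactorisationSeven_of_inputs₁₂ fun F θu hθu =>
    ⟨(h F θu hθu).1, fun _ hval => F.sinnottSpanShape_of_pin hT hval, (h F θu hθu).2⟩

/-- ★ **THE REGISTERED (zp v12) INPUT-FORM STUB `stub_genusUnitSideInputsSeven`, statement VERBATIM as conclusion, with (4b)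
discharged modulo Tsuji's Lemma 6.2 (a)**: per value-pinned frame it remains to supply (2b″) the global norm relations of the
twelfth powers of the elliptic family and (5) the identity; (2a)/(3a) principality (`isPrincipalPowFamily`, p778024), (3b′) the
Sinnott norm relations (`isGlobalNormCoherent_of_sinnott_pin`, p780861) and (4b) (`sinnottSpanShape_of_pin`) are supplied here.
Conditional theorem; neither hypothesis is proved here.
[cite: Tsuji1999, §6 Lemma 6.2 (a) (p. 21)] [cite: Kato2004Asterisque, §15.5–15.6 (pp. 253–254)] [cite: deShalit1987, II.2.5 Proposition (i)] -/
theorem genusUnitSideInputsSeven_of_inputs₂₅ (hT : tsuji1999_lemma62a_cycChiGenerator)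
    (h : ∀ (F : GenusFrame) (θu : ∀ n : ℕ, globalUnitsOf (F.layer n)), IsNormedEllipticUnitFamily F θu →
      F.IsGlobalNormCoherent (fun n => θu n ^ 12) ∧ UnitSideIdentityShape F θu) :
    ∀ (F : GenusSeven.GenusFrame) (θu : ∀ n : ℕ, globalUnitsOf (F.layer n)), GenusSeven.IsNormedEllipticUnitFamily F θu →
      (F.IsPrincipalPowFamily θu ∧ F.IsNormCoherentPowFamily θu) ∧
        (∀ ξu : ∀ n : ℕ, globalUnitsOf (F.layer n),
          (∀ n : ℕ, (((ξu n : globalUnitsOf (F.layer n)) : (AlgebraicClosure ℚ)ˣ) : AlgebraicClosure ℚ) =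
              CyclotomicUnits.sinnottNorm (t := 7 ^ (n + 1) * F.d) (F.layer n) (F.ζsys n) 1) →
            (F.IsPrincipalPowFamily ξu ∧ F.IsNormCoherentPowFamily ξu) ∧ GenusSeven.SinnottSpanShape F ξu) ∧
        GenusSeven.UnitSideIdentityShape F θu := by
  intro F θu hθu
  obtain ⟨hN, hid⟩ := h F θu hθu
  exact ⟨⟨F.isPrincipalPowFamily θu, F.isNormCoherentPowFamily_of_isGlobalNormCoherent_pow (m := 12) (k := 4) rfl hN⟩,
    fun ξu hval => ⟨⟨F.isPrincipalPowFamily ξu,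
      F.isNormCoherentPowFamily_of_isGlobalNormCoherent (F.isGlobalNormCoherent_of_sinnott_pin hval)⟩,
      F.sinnottSpanShape_of_pin hT hval⟩, hid⟩

end Summit.BirchSwinnertonDyer.Rank1Residual.Additive.GenusSeven

end
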